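import Summits.QuantumFields.BalabanUV.T4Continuum.Spine.NE1p.DressedSmallFieldTBoxMixedLetterSourceCommute

/-!
# T⁴ programme, spine estimate NE1′ (node O3b/H2) — THE RESPONSE OF AN EXPONENTIAL INSERTION IS AN INSERTION: for a factor of the (2.14) form
# `E(μ; v) = G(v)·exp Φ(μ; v)` (the source coupled through the EXPONENT, as an observable term added to the action is), `∂_μ E = (∂_μ Φ)·E`, so
# by W103 `∂_μ (1.23)(E(μ)) = (1.23)((∂_μΦ)(μ)·E(μ))` — a letter OF THE SAME TYPE with the response of the exponent inserted — and (1.24)'s shape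
# bounds it by `ρ⁻¹·(R₁·A)·e^{−(κ₁−1)·#S}` with the constants `R₁ ≥ |∂_μΦ|`, `A ≥ |E|` of the datum AT THAT `μ`: NO strict sub-window, NO
# `(μ₁′ − μ₀)⁻¹`; for an AFFINE coupling `Φ = Φ₀ + μ·O` every order is an insertion, `∂^k_μ (1.23)(E(μ)) = (1.23)(O^k·E(μ))`, cost `ρ⁻¹·(R₁^k·A)·e^{…}`

Cell `pub-balaban`, sub-cell `t4`, row NE1′ formalisation crew (`t4/formal/NE1p/LEAVES.md` row W112 ∕ DAG N29zzzzzzd, BOOKED typer R-T157 journal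
l.25813, cap 350, X-read X261 — own-initiative DICTIONARY follower of
the unit's W103 «THE SOURCE DERIVATIVE COMMUTES INTO THE LETTER» (p245083) and of its «SourceSeries» row (p245467), under typer R-T61 (ii); the
structural COMPLEMENT of leaf-06-g14's W102 `DressedMuWindowSharpnessWitness` «THE THIRD RADIUS IS NOT FOR SALE» (p245020): there, for GENERIC
`M`-bounded holomorphic `E`, the window quotient is attained; here, for the EXPONENTIAL source structure, it is absent), unit
`b2b-balaban-t4-ne1p-formalise-leaf-08` (gen 14).  ADDITIVE — imports W103 `Spine/NE1p/DressedSmallFieldTBoxMixedLetterSourceCommute` ONLY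
(`deriv_tBoxMixedLetter_source`, `iteratedDeriv_tBoxMixedLetter_source`, `norm_deriv_tBoxMixedLetter_source_le`, `norm_iteratedDeriv_tBoxMixedLetter_source_le`,
`analyticOnNhd_deriv_source`, `cons_mem_polyBall`; → W93 `analyticOnNhd_section`∕`tBoxMixedLetter_eq_spectator`, W89 `tBoxMixedLetter_eq_mixedDiff_deriv_local`∕
`indicator_mem_pi`, W76 `mixedDiff_congr_vertices`, W55 `analyticOnNhd_apply`, W39.1 `mixedDiff_pair`, the substrate's `w₁`∕`circ`, the template's
`polydisc` — BY NAME) + Mathlib (`HasDerivAt.cexp`, `AnalyticOnNhd.cexp`, `Filter.EventuallyEq.deriv_eq`).  THEOREMS ONLY + `example`s; 0 `def`,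
0 `instance`, 0 `def … : Prop`, 0 cite, 0 sorry, 0 `attribute`; nothing upstream restated; nothing of W102 imported or restated (cross-reference in prose only).

WHY THIS FILE.  The cell's precision note (n2) (t4-ref2, GAPS-T4 C-t4r2-340, a CELL record) says termwise μ-differentiation «needs a third Cauchy
radius in μ»; W98∕«SourceSeries» typed that price (`k!·B∕(μ₁′ − μ₀)^k`) and W102 showed it is ATTAINED for generic `M`-bounded holomorphic data;
the owner's rider on W102 (g41) records that Bałaban's dressed activities carry «more structure than `M`-boundedness — per-term (2.14)∕(2.20)
data — so a window-free response bound for THEM is neither asserted nor excluded».  One piece of that structure is visible in print's (2.14)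
itself: the potentials enter through an EXPONENTIAL, `exp[Σ_{Y∈D} τ(Y)V_k(Y,B)]` ([Balaban1988RGII] p. 15 (2.14); p. 16 (2.20) bounds
`Σ|τ(Y)||V_k(Y,B)|` — LOCI of the audited manuscript, TYPE∕CONTEXT only; print has NO source μ — the μ-extension is the cell's, note (n1)).  For a
source coupled through such an exponent the calculus is different in KIND, and this file types it at the letter object:
* §1 [folklore] **`tBoxMixedLetter_congr_of_eqOn`**: the (1.23) letter depends on the factor only through its values on the OPEN polydisc of
  analyticity — two factors analytic there and equal there have the same letter (W89's local representation + W76 `mixedDiff_congr_vertices` +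
  `Filter.EventuallyEq.deriv_eq` on the vertex slices; no measure theory);
* §2 [folklore] the exponential datum: **`hasDerivAt_mul_cexp_source`** `∂_μ (G·e^{Φ(μ)}) = (∂_μΦ)·(G·e^{Φ(μ)})` (Mathlib `HasDerivAt.cexp`);
  **`iteratedDeriv_mul_cexp_affine`**: for `Φ = Φ₀ + μ·O`, `∂^k_μ (G·e^{Φ₀ + μO}) = O^k·(G·e^{Φ₀ + μO})` at EVERY order; **`analyticOnNhd_mul_cexp`**:
  `(μ, v) ↦ G(v)·e^{Φ(μ;v)}` is jointly analytic when `G` is analytic on the polydisc and `Φ` jointly analytic;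
* §3 **`deriv_tBoxMixedLetter_exp_source`** (kernel): for `G` analytic on `Π_j{|v_j| < R_j}`, `Φ` jointly analytic on `W × Π_j{|v_j| < R_j}` (`W ⊆ ℂ`
  open), `0 < ρ < R₀`, `1 < r_j < R_{j+1}`, `μ ∈ W`: `∂∕∂μ (1.23)(G·e^{Φ(μ)}) = (1.23)((∂_μΦ)(μ)·G·e^{Φ(μ)})` — W103 ONCE + §1 on the two analytic fields
  `∂_μE(μ;·)` and `(∂_μΦ·E)(μ;·)`, equal on the polydisc by §2; **`iteratedDeriv_tBoxMixedLetter_affine_source`**: for the affine coupling every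
  source derivative of the letter is the letter with `O^k` inserted (W103 §3 ONCE + §2, for ALL `μ ∈ W`);
* §4 **`norm_deriv_tBoxMixedLetter_exp_source_le`**: with `κ₁ ≥ 1`, `R_{j+1} > e^{κ₁}` and bounds `‖∂_μΦ(μ; t ∷ z)‖ ≤ R₁`, `‖G(t ∷ z)·e^{Φ(μ; t ∷ z)}‖ ≤ A`
  on `{|t| = ρ} × {|z_j| ≤ e^{κ₁}}` AT THE SOURCE `μ` (HYPOTHESES of (2.20)∕(1.21) TYPE): `‖∂_μ (1.23)(μ)‖ ≤ ρ⁻¹·(R₁·A)·e^{−(κ₁−1)·#S}` — W103's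
  currency `A₁` SUPPLIED as `R₁·A` by the product rule, with NO window quotient; **`norm_iteratedDeriv_tBoxMixedLetter_affine_source_le`**: affine,
  order `k`: `≤ ρ⁻¹·(R₁^k·A)·e^{−(κ₁−1)·#S}` with `‖O‖ ≤ R₁` — versus «SourceSeries»' generic `k!·B∕(μ₁′ − μ₀)^k` and W102's attained quotient: for
  the exponential structure the source derivatives are INSERTIONS and cost powers of the insertion's size, not inverse powers of a window;
* §5 decided (`E = exp(μ·t·z₀z₁)`: `G = 1`, `Φ₀ = 0`, `O = t·z₀z₁`; `t_□`-radius `1`, cube radii `3∕2`, ALL `μ ∈ ℂ`): `∂_μ (1.23)(μ) = (1.23)(O·E(μ)) =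
  Δ_{01}(z₀z₁) = 1` and `∂²_μ (1.23)(μ) = (1.23)(O²·E(μ)) = 0` (the letter is `μ`, entire and linear in the source — no window anywhere).

HONEST FRAMING.  [folklore] one-variable calculus (product∕chain rule for `exp`, analyticity of products and exponentials — Mathlib) + W103∕W93∕
W89∕W76 BY NAME on OUR dictionary objects; a DICTIONARY row — WHAT the source derivative of an exponentially-coupled (2.14)-type letter IS and what it
costs, NOT an estimate of print and NOT a statement about Bałaban's densities: that the dressed small-field factor has the form `G·e^{Φ(μ)}` with
`Φ` affine (or analytic) in the cell's source and with (2.20)-type bounds `R₁` on `∂_μΦ` is a TYPE READING of (2.14)'s `exp[Σ τ(Y)V_k(Y,B)]` under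
the cell's μ-extension (notes (n1)∕(n2), CELL records) — for Bałaban's dressed input that reading and those bounds are exactly (w1)∕(B2)-type
birth data, NEW-UNPRINTED, HYPOTHESES here; the row RELOCATES «where the third radius is needed» to the FORM of the source coupling and discharges
nothing; in particular it does NOT assert that the cell's dressed activities are exponentially-affine in μ at every step (renormalisation may
destroy affinity; then §3's first-order form applies with `∂_μΦ` a datum, or W98∕«SourceSeries»' windowed form); `G`, `Φ`, `O`, `R₁`, `A`, radii are
HYPOTHESES∕symbols; (2.20), Lemma 3, `C₃`, (1.25) NOT touched; no numeral of [Balaban1988RGII] asserted (k2); (w5)∕(w5b)∕(w6) NOT discharged ((w6)'s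
window stays the cell's bookkeeping for the GENERIC route); (B1) for Bałaban's (2.14) NOT discharged; (B3) = GAPS G-ne9p2-5 UNPRINTED — NOT
discharged, untouched; (B5) untouched; 0 binders instantiated on Bałaban's densities ∕ operators ∕ (2.14) data ∕ `d_k` ∕ minimisers ∕ backgrounds;
discharges no wall item; wall v1.8 (T4-DAG v48) does NOT move; R-t4r2-Q2 NOT met thereby; NE1′ ⇐ the named binders — NOT proved, NOT printed; spine
PROVED 0∕9; count 9 unchanged.  Rung (B)+1 on ONE finite four-torus — NOT infinite volume, NOT a mass gap, NOT OS on ℝ⁴, NOT Clay.  ABSOLUTE RULE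
honoured: the quotations are LOCI of the audited manuscript [Balaban1988RGII] (CMP 116 (1988) 1–22, pp. 15–16), TYPE∕CONTEXT only, never
hypothesis-free facts; the referee note and the owner's rider are CELL records quoted as such; nothing internally minted is cited as a fact;
[folklore] tags on kernel lemmas only.  HONEST DEPENDENCY: continuum YM on T⁴ ⇐ BetaPertH ∧ nine spine estimates (0/9 proved); BetaPertH ⇐ (D1) ∧
(D4) ∧ CAP+tail; G-an2-4 gates asym, D1 and NE2/3/4.
-/

noncomputable section

namespace Summit.QuantumFields.BalabanUV.T4Continuum.NE1p.DressedSmallFieldTBoxMixedLetterSourceInsertion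

open MeasureTheory Metric Set Complex Finset Function Filter
open scoped BigOperators Topology
open Summit.QuantumFields.BalabanUV.T4Continuum.B13TermContours
open Summit.QuantumFields.BalabanUV.T4Continuum.NE1p.DressedSmallFieldMixedLetter
open Summit.QuantumFields.BalabanUV.T4Continuum.NE1p.DressedSmallFieldMixedDerivativeBridge (analyticOnNhd_apply)
open Summit.QuantumFields.BalabanUV.T4Continuum.NE1p.DressedSmallFieldMixedDifferenceClosedForm (mixedDiff_congr_vertices)
open Summit.QuantumFields.BalabanUV.T4Continuum.NE1p.DressedSmallFieldTBoxMixedLetterLocal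
  (indicator_mem_pi tBoxMixedLetter_eq_mixedDiff_deriv_local differentiableOn_tSection)
open Summit.QuantumFields.BalabanUV.T4Continuum.NE1p.DressedSmallFieldTBoxMixedLetterSpectator (analyticOnNhd_section tBoxMixedLetter_eq_spectator)
open Summit.QuantumFields.BalabanUV.T4Continuum.NE1p.DressedSmallFieldTBoxMixedLetterSourceCommute
open Literature.MathematicalPhysics.QuantumFieldTheory.Dimock2011to13.PolydiscCauchyBounds (polydisc)

variable {n : ℕ}

/-! ## §1 [folklore] The letter sees the factor only on the open polydisc -/

/-- **THE (1.23) LETTER DEPENDS ON THE FACTOR ONLY THROUGH ITS VALUES ON THE OPEN POLYDISC** [folklore] (W89 `tBoxMixedLetter_eq_mixedDiff_deriv_local`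
on both factors, W76 `mixedDiff_congr_vertices`, and `Filter.EventuallyEq.deriv_eq` on every vertex slice `t ↦ E_i(t ∷ 𝟙_T)`, which agree on
the head disc `|t| < R₀` because the vertices lie in the polydisc): for `E₁`, `E₂` analytic on `{|t| < R₀} × Π_j{|σ_j| < R_{j+1}}` and equal
there, `0 < ρ < R₀`, `1 < r_j < R_{j+1}`, the two letters coincide. -/
theorem tBoxMixedLetter_congr_of_eqOn {ρ : ℝ} (hρ : 0 < ρ) {r : Fin n → ℝ} {R : Fin (n + 1) → ℝ} (hρR : ρ < R 0)
    (hr : ∀ j, 1 < r j) (hrR : ∀ j : Fin n, r j < R j.succ) (S : Finset (Fin n)) {E₁ E₂ : (Fin (n + 1) → ℂ) → ℂ}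
    (hE₁ : AnalyticOnNhd ℂ E₁ (Set.univ.pi fun j => ball (0 : ℂ) (R j)))
    (hE₂ : AnalyticOnNhd ℂ E₂ (Set.univ.pi fun j => ball (0 : ℂ) (R j)))
    (h : EqOn E₁ E₂ (Set.univ.pi fun j => ball (0 : ℂ) (R j))) :
    (∫ θ₀ in Icc 0 (2 * Real.pi), w₁ ρ (0, θ₀) * ∫ p, wS r S p * E₁ (Fin.cons (circ ρ θ₀) (σS r S p)) ∂(Measure.pi (μS S))) =
      ∫ θ₀ in Icc 0 (2 * Real.pi), w₁ ρ (0, θ₀) * ∫ p, wS r S p * E₂ (Fin.cons (circ ρ θ₀) (σS r S p)) ∂(Measure.pi (μS S)) := by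
  have h1 : ∀ j : Fin n, 1 < R j.succ := fun j => (hr j).trans (hrR j)
  rw [tBoxMixedLetter_eq_mixedDiff_deriv_local hρ hρR hr hrR S hE₁, tBoxMixedLetter_eq_mixedDiff_deriv_local hρ hρR hr hrR S hE₂]
  refine mixedDiff_congr_vertices fun T _ => Filter.EventuallyEq.deriv_eq ?_
  filter_upwards [isOpen_ball.mem_nhds (mem_ball_self (hρ.trans hρR))] with t ht
  refine h (Set.mem_univ_pi.2 fun j => ?_)
  induction j using Fin.cases with
  | zero => simpa using ht
  | succ i => exact (Set.mem_univ_pi.1 (indicator_mem_pi h1 T)) i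

/-! ## §2 [folklore] The exponential datum `E(μ; v) = G(v)·exp Φ(μ; v)`: its source derivatives are insertions -/

/-- **`∂_μ (G·e^{Φ(μ)}) = (∂_μΦ)·(G·e^{Φ(μ)})`** [folklore] (Mathlib `HasDerivAt.cexp`, `const_mul`): the source derivative of an exponentially
coupled factor is the factor with the exponent's response INSERTED. -/
theorem hasDerivAt_mul_cexp_source {G : ℂ} {Φ : ℂ → ℂ} {Φ' μ : ℂ} (hΦ : HasDerivAt Φ Φ' μ) :
    HasDerivAt (fun μ' : ℂ => G * cexp (Φ μ')) (Φ' * (G * cexp (Φ μ))) μ :=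
  (hΦ.cexp.const_mul G).congr_deriv (by ring)

/-- [folklore] … in `deriv` form. -/
theorem deriv_mul_cexp_source {G : ℂ} {Φ : ℂ → ℂ} {μ : ℂ} (hΦ : DifferentiableAt ℂ Φ μ) :
    deriv (fun μ' : ℂ => G * cexp (Φ μ')) μ = deriv Φ μ * (G * cexp (Φ μ)) :=
  (hasDerivAt_mul_cexp_source hΦ.hasDerivAt).deriv

/-- **AFFINE COUPLING: EVERY SOURCE DERIVATIVE IS AN INSERTION** [folklore]: for `Φ(μ) = Φ₀ + μ·O`,
`∂^k∕∂μ^k (G·e^{Φ₀ + μO}) = O^k·(G·e^{Φ₀ + μO})` (induction; `iteratedDeriv_succ`). -/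
theorem iteratedDeriv_mul_cexp_affine (G Φ₀ O : ℂ) :
    ∀ (k : ℕ) (μ : ℂ), iteratedDeriv k (fun μ' : ℂ => G * cexp (Φ₀ + μ' * O)) μ = O ^ k * (G * cexp (Φ₀ + μ * O))
  | 0, μ => by simp
  | k + 1, μ => by
      have hfun : iteratedDeriv k (fun μ' : ℂ => G * cexp (Φ₀ + μ' * O)) = fun μ' => O ^ k * (G * cexp (Φ₀ + μ' * O)) :=
        funext (iteratedDeriv_mul_cexp_affine G Φ₀ O k)
      have hd : HasDerivAt (fun μ' : ℂ => O ^ k * (G * cexp (Φ₀ + μ' * O))) (O ^ k * ((1 * O) * (G * cexp (Φ₀ + μ * O)))) μ :=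
        (hasDerivAt_mul_cexp_source (((hasDerivAt_id μ).mul_const O).const_add Φ₀)).const_mul (O ^ k)
      rw [iteratedDeriv_succ, hfun, hd.deriv]
      ring

/-- **THE EXPONENTIAL DATUM IS JOINTLY ANALYTIC** [folklore]: for `G` analytic on the polydisc and `Φ` jointly analytic on `W × polydisc`,
`(μ, v) ↦ G(v)·e^{Φ(μ;v)}` is jointly analytic there (Mathlib `AnalyticOnNhd.mul`, `AnalyticOnNhd.cexp`). -/
theorem analyticOnNhd_mul_cexp {W : Set ℂ} {R : Fin (n + 1) → ℝ} {G : (Fin (n + 1) → ℂ) → ℂ} {Φ : ℂ → (Fin (n + 1) → ℂ) → ℂ}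
    (hG : AnalyticOnNhd ℂ G (Set.univ.pi fun j => ball (0 : ℂ) (R j)))
    (hΦ : AnalyticOnNhd ℂ (fun q : ℂ × (Fin (n + 1) → ℂ) => Φ q.1 q.2) (W ×ˢ Set.univ.pi fun j => ball (0 : ℂ) (R j))) :
    AnalyticOnNhd ℂ (fun q : ℂ × (Fin (n + 1) → ℂ) => G q.2 * cexp (Φ q.1 q.2)) (W ×ˢ Set.univ.pi fun j => ball (0 : ℂ) (R j)) :=
  (hG.comp analyticOnNhd_snd fun _ hq => hq.2).mul hΦ.cexp

/-- [folklore] On `W × polydisc` the source-derivative FIELD of the exponential datum is the inserted field (§2 pointwise; the `Φ`-slice is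
differentiable at `μ` by joint analyticity). -/
theorem deriv_source_mul_cexp_eq {W : Set ℂ} {R : Fin (n + 1) → ℝ} {G : (Fin (n + 1) → ℂ) → ℂ} {Φ : ℂ → (Fin (n + 1) → ℂ) → ℂ}
    (hΦ : AnalyticOnNhd ℂ (fun q : ℂ × (Fin (n + 1) → ℂ) => Φ q.1 q.2) (W ×ˢ Set.univ.pi fun j => ball (0 : ℂ) (R j)))
    {μ : ℂ} (hμ : μ ∈ W) {v : Fin (n + 1) → ℂ} (hv : v ∈ Set.univ.pi fun j => ball (0 : ℂ) (R j)) :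
    deriv (fun μ' : ℂ => G v * cexp (Φ μ' v)) μ = deriv (fun μ' : ℂ => Φ μ' v) μ * (G v * cexp (Φ μ v)) :=
  deriv_mul_cexp_source ((hΦ _ ⟨hμ, hv⟩).comp_of_eq
    ((analyticAt_id.prod analyticAt_const)) rfl).differentiableAt

/-! ## §3 THE RESPONSE OF AN EXPONENTIAL INSERTION IS AN INSERTION -/

/-- **`∂∕∂μ (1.23)(G·e^{Φ(μ)}) = (1.23)((∂_μΦ)(μ)·G·e^{Φ(μ)})`** (kernel; W103 `deriv_tBoxMixedLetter_source` ONCE on the jointly analytic datum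
`E = G·e^Φ` (§2 `analyticOnNhd_mul_cexp`), then §1 `tBoxMixedLetter_congr_of_eqOn` between the two fields `∂_μE(μ; ·)` (analytic: W103
`analyticOnNhd_deriv_source`, W93 `analyticOnNhd_section`) and `(∂_μΦ·E)(μ; ·)` (analytic: products), which agree on the polydisc by §2
`deriv_source_mul_cexp_eq`): for `G` analytic on `Π_j{|v_j| < R_j}`, `Φ` jointly analytic on `W × Π_j{|v_j| < R_j}` (`W ⊆ ℂ` open), the
`t_□`-radius `0 < ρ < R₀`, contour radii `1 < r_j < R_{j+1}` and `μ ∈ W`, the source derivative of the (1.23)∕(2.14)-type letter of `G·e^{Φ(μ)}` is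
the letter OF THE SAME TYPE with the exponent's response inserted — the cell's «linear response» of an exponentially coupled term (notes
(n1)∕(n2), CELL records; [Balaban1988RGII] (2.14)'s `exp[Σ τ(Y)V_k(Y,B)]`, TYPE), nothing of print claimed. [folklore] -/
theorem deriv_tBoxMixedLetter_exp_source {W : Set ℂ} (hW : IsOpen W) {ρ : ℝ} (hρ : 0 < ρ) {r : Fin n → ℝ} {R : Fin (n + 1) → ℝ}
    (hρR : ρ < R 0) (hr : ∀ j, 1 < r j) (hrR : ∀ j : Fin n, r j < R j.succ) (S : Finset (Fin n))
    {G : (Fin (n + 1) → ℂ) → ℂ} {Φ : ℂ → (Fin (n + 1) → ℂ) → ℂ}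
    (hG : AnalyticOnNhd ℂ G (Set.univ.pi fun j => ball (0 : ℂ) (R j)))
    (hΦ : AnalyticOnNhd ℂ (fun q : ℂ × (Fin (n + 1) → ℂ) => Φ q.1 q.2) (W ×ˢ Set.univ.pi fun j => ball (0 : ℂ) (R j)))
    {μ : ℂ} (hμ : μ ∈ W) :
    deriv (fun μ' : ℂ => ∫ θ₀ in Icc 0 (2 * Real.pi), w₁ ρ (0, θ₀) *
        ∫ p, wS r S p * (G (Fin.cons (circ ρ θ₀) (σS r S p)) * cexp (Φ μ' (Fin.cons (circ ρ θ₀) (σS r S p)))) ∂(Measure.pi (μS S))) μ =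
      ∫ θ₀ in Icc 0 (2 * Real.pi), w₁ ρ (0, θ₀) *
        ∫ p, wS r S p * (deriv (fun μ' : ℂ => Φ μ' (Fin.cons (circ ρ θ₀) (σS r S p))) μ *
          (G (Fin.cons (circ ρ θ₀) (σS r S p)) * cexp (Φ μ (Fin.cons (circ ρ θ₀) (σS r S p))))) ∂(Measure.pi (μS S)) := by
  have hE := analyticOnNhd_mul_cexp hG hΦ
  rw [deriv_tBoxMixedLetter_source hW hρ hρR hr hrR S (E := fun μ' v => G v * cexp (Φ μ' v)) hE hμ]
  -- the two fields `∂_μE(μ;·)` and `(∂_μΦ·E)(μ;·)` are analytic on the polydisc and agree there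
  have hΦ' := analyticOnNhd_deriv_source hW hΦ
  refine tBoxMixedLetter_congr_of_eqOn hρ hρR hr hrR S
    (analyticOnNhd_section (E := fun μ' v => deriv (fun μ'' : ℂ => G v * cexp (Φ μ'' v)) μ')
      (analyticOnNhd_deriv_source (E := fun μ' v => G v * cexp (Φ μ' v)) hW hE) hμ)
    (((analyticOnNhd_section (E := fun μ' v => deriv (fun μ'' : ℂ => Φ μ'' v) μ') hΦ' hμ)).mul
      (analyticOnNhd_section (E := fun μ' v => G v * cexp (Φ μ' v)) hE hμ)) fun v hv => ?_
  exact deriv_source_mul_cexp_eq hΦ hμ hv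

/-- **AFFINE COUPLING: EVERY SOURCE DERIVATIVE OF THE LETTER IS THE LETTER WITH `O^k` INSERTED** (kernel; W103 §3
`iteratedDeriv_tBoxMixedLetter_source` ONCE + §2 `iteratedDeriv_mul_cexp_affine` pointwise, valid at EVERY `v` — no congruence needed): for `G`, `Φ₀`,
`O` analytic on the polydisc, the datum `E(μ; v) = G(v)·e^{Φ₀(v) + μ·O(v)}` (jointly analytic on `W × polydisc` for any open `W ⊆ ℂ` — it is ENTIRE in
the source), `0 < ρ < R₀`, `1 < r_j < R_{j+1}`, every `k` and every `μ ∈ W`: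
`∂^k∕∂μ^k (1.23)(E(·))(μ) = (1.23)(O^k·E(μ))`. [folklore] -/
theorem iteratedDeriv_tBoxMixedLetter_affine_source {W : Set ℂ} (hW : IsOpen W) {ρ : ℝ} (hρ : 0 < ρ) {r : Fin n → ℝ} {R : Fin (n + 1) → ℝ}
    (hρR : ρ < R 0) (hr : ∀ j, 1 < r j) (hrR : ∀ j : Fin n, r j < R j.succ) (S : Finset (Fin n))
    {G Φ₀ O : (Fin (n + 1) → ℂ) → ℂ} (hG : AnalyticOnNhd ℂ G (Set.univ.pi fun j => ball (0 : ℂ) (R j)))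
    (hΦ₀ : AnalyticOnNhd ℂ Φ₀ (Set.univ.pi fun j => ball (0 : ℂ) (R j))) (hO : AnalyticOnNhd ℂ O (Set.univ.pi fun j => ball (0 : ℂ) (R j)))
    (k : ℕ) {μ : ℂ} (hμ : μ ∈ W) :
    iteratedDeriv k (fun μ' : ℂ => ∫ θ₀ in Icc 0 (2 * Real.pi), w₁ ρ (0, θ₀) *
        ∫ p, wS r S p * (G (Fin.cons (circ ρ θ₀) (σS r S p)) *
          cexp (Φ₀ (Fin.cons (circ ρ θ₀) (σS r S p)) + μ' * O (Fin.cons (circ ρ θ₀) (σS r S p)))) ∂(Measure.pi (μS S))) μ =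
      ∫ θ₀ in Icc 0 (2 * Real.pi), w₁ ρ (0, θ₀) *
        ∫ p, wS r S p * (O (Fin.cons (circ ρ θ₀) (σS r S p)) ^ k * (G (Fin.cons (circ ρ θ₀) (σS r S p)) *
          cexp (Φ₀ (Fin.cons (circ ρ θ₀) (σS r S p)) + μ * O (Fin.cons (circ ρ θ₀) (σS r S p))))) ∂(Measure.pi (μS S)) := by
  -- the affine exponent is jointly analytic
  have hΦ : AnalyticOnNhd ℂ (fun q : ℂ × (Fin (n + 1) → ℂ) => Φ₀ q.2 + q.1 * O q.2) (W ×ˢ Set.univ.pi fun j => ball (0 : ℂ) (R j)) :=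
    (hΦ₀.comp analyticOnNhd_snd fun _ hq => hq.2).add (analyticOnNhd_fst.mul (hO.comp analyticOnNhd_snd fun _ hq => hq.2))
  rw [iteratedDeriv_tBoxMixedLetter_source hW hρ hρR hr hrR S (E := fun μ' v => G v * cexp (Φ₀ v + μ' * O v))
    (analyticOnNhd_mul_cexp (Φ := fun μ' v => Φ₀ v + μ' * O v) hG hΦ) k hμ]
  simp_rw [iteratedDeriv_mul_cexp_affine]

/-! ## §4 NO THIRD RADIUS: the response costs the size of the insertion, at the source itself -/

/-- **(1.24)'s SHAPE FOR THE RESPONSE OF AN EXPONENTIAL INSERTION — NO WINDOW QUOTIENT** (kernel; W103 `norm_deriv_tBoxMixedLetter_source_le` with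
its currency `A₁` SUPPLIED as `R₁·A` by §2's product rule at every contour point): for `G` analytic on the polydisc, `Φ` jointly analytic on
`W × polydisc`, `κ₁ ≥ 1`, `R_{j+1} > e^{κ₁}`, `0 < ρ < R₀`, `1 < r_j < R_{j+1}`, `μ ∈ W`, and bounds AT THE SOURCE `μ` on `{|t| = ρ} × {|z_j| ≤ e^{κ₁}}`:
`‖∂_μΦ(μ; t ∷ z)‖ ≤ R₁` (the exponent's response — a (2.20)-type datum) and `‖G(t ∷ z)·e^{Φ(μ; t ∷ z)}‖ ≤ A` ((1.21)∕(2.14)-data type):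
`‖∂∕∂μ (1.23)(G·e^{Φ(μ)})‖ ≤ ρ⁻¹ · (R₁·A) · e^{−(κ₁−1)·#S}` — constants of the datum at `μ`, NOT `A∕(μ₁′ − μ₀)`: where the source enters through
the exponent the third radius of (n2) is NOT spent (contrast W98∕«SourceSeries»' generic `B∕(μ₁′ − μ₀)` and W102's attained quotient). [folklore] -/
theorem norm_deriv_tBoxMixedLetter_exp_source_le {W : Set ℂ} (hW : IsOpen W) {ρ : ℝ} (hρ : 0 < ρ) {r : Fin n → ℝ}
    {R : Fin (n + 1) → ℝ} (hρR : ρ < R 0) (hr : ∀ j, 1 < r j) (hrR : ∀ j : Fin n, r j < R j.succ) {κ₁ R₁ A : ℝ} (hκ : 1 ≤ κ₁)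
    (hRκ : ∀ j : Fin n, Real.exp κ₁ < R j.succ) (S : Finset (Fin n)) {G : (Fin (n + 1) → ℂ) → ℂ} {Φ : ℂ → (Fin (n + 1) → ℂ) → ℂ}
    (hG : AnalyticOnNhd ℂ G (Set.univ.pi fun j => ball (0 : ℂ) (R j)))
    (hΦ : AnalyticOnNhd ℂ (fun q : ℂ × (Fin (n + 1) → ℂ) => Φ q.1 q.2) (W ×ˢ Set.univ.pi fun j => ball (0 : ℂ) (R j)))
    {μ : ℂ} (hμ : μ ∈ W)
    (hR₁ : ∀ t : ℂ, ‖t‖ = ρ → ∀ z ∈ polydisc (fun _ : Fin n => Real.exp κ₁), ‖deriv (fun μ' : ℂ => Φ μ' (Fin.cons t z)) μ‖ ≤ R₁)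
    (hA : ∀ t : ℂ, ‖t‖ = ρ → ∀ z ∈ polydisc (fun _ : Fin n => Real.exp κ₁), ‖G (Fin.cons t z) * cexp (Φ μ (Fin.cons t z))‖ ≤ A) :
    ‖deriv (fun μ' : ℂ => ∫ θ₀ in Icc 0 (2 * Real.pi), w₁ ρ (0, θ₀) *
        ∫ p, wS r S p * (G (Fin.cons (circ ρ θ₀) (σS r S p)) * cexp (Φ μ' (Fin.cons (circ ρ θ₀) (σS r S p)))) ∂(Measure.pi (μS S))) μ‖ ≤
      ρ⁻¹ * (R₁ * A * Real.exp (-((κ₁ - 1) * S.card))) := by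
  refine norm_deriv_tBoxMixedLetter_source_le hW hρ hρR hr hrR hκ hRκ S (E := fun μ' v => G v * cexp (Φ μ' v))
    (analyticOnNhd_mul_cexp hG hΦ) hμ fun t ht z hz => ?_
  rw [deriv_source_mul_cexp_eq hΦ hμ (cons_mem_polyBall hρR hRκ ht hz), norm_mul]
  exact mul_le_mul (hR₁ t ht z hz) (hA t ht z hz) (norm_nonneg _) (le_trans (norm_nonneg _) (hR₁ t ht z hz))

/-- **AFFINE COUPLING, ORDER `k`: `‖∂^k_μ (1.23)(μ)‖ ≤ ρ⁻¹·(R₁^k·A)·e^{−(κ₁−1)·#S}`** (kernel; W103 `norm_iteratedDeriv_tBoxMixedLetter_source_le` with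
`A_k := R₁^k·A` from §2 `iteratedDeriv_mul_cexp_affine`): under `‖O(t ∷ z)‖ ≤ R₁` and `‖G(t ∷ z)·e^{Φ₀(t ∷ z) + μ·O(t ∷ z)}‖ ≤ A` on the contour set at
the source `μ` — powers of the insertion's size in place of «SourceSeries»' `k!∕(μ₁′ − μ₀)^k`. [folklore] -/
theorem norm_iteratedDeriv_tBoxMixedLetter_affine_source_le {W : Set ℂ} (hW : IsOpen W) {ρ : ℝ} (hρ : 0 < ρ) {r : Fin n → ℝ}
    {R : Fin (n + 1) → ℝ} (hρR : ρ < R 0) (hr : ∀ j, 1 < r j) (hrR : ∀ j : Fin n, r j < R j.succ) {κ₁ R₁ A : ℝ} (hκ : 1 ≤ κ₁)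
    (hRκ : ∀ j : Fin n, Real.exp κ₁ < R j.succ) (S : Finset (Fin n)) {G Φ₀ O : (Fin (n + 1) → ℂ) → ℂ}
    (hG : AnalyticOnNhd ℂ G (Set.univ.pi fun j => ball (0 : ℂ) (R j))) (hΦ₀ : AnalyticOnNhd ℂ Φ₀ (Set.univ.pi fun j => ball (0 : ℂ) (R j)))
    (hO : AnalyticOnNhd ℂ O (Set.univ.pi fun j => ball (0 : ℂ) (R j))) (k : ℕ) {μ : ℂ} (hμ : μ ∈ W)
    (hR₁ : ∀ t : ℂ, ‖t‖ = ρ → ∀ z ∈ polydisc (fun _ : Fin n => Real.exp κ₁), ‖O (Fin.cons t z)‖ ≤ R₁)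
    (hA : ∀ t : ℂ, ‖t‖ = ρ → ∀ z ∈ polydisc (fun _ : Fin n => Real.exp κ₁),
      ‖G (Fin.cons t z) * cexp (Φ₀ (Fin.cons t z) + μ * O (Fin.cons t z))‖ ≤ A) :
    ‖iteratedDeriv k (fun μ' : ℂ => ∫ θ₀ in Icc 0 (2 * Real.pi), w₁ ρ (0, θ₀) *
        ∫ p, wS r S p * (G (Fin.cons (circ ρ θ₀) (σS r S p)) *
          cexp (Φ₀ (Fin.cons (circ ρ θ₀) (σS r S p)) + μ' * O (Fin.cons (circ ρ θ₀) (σS r S p)))) ∂(Measure.pi (μS S))) μ‖ ≤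
      ρ⁻¹ * (R₁ ^ k * A * Real.exp (-((κ₁ - 1) * S.card))) := by
  have hΦ : AnalyticOnNhd ℂ (fun q : ℂ × (Fin (n + 1) → ℂ) => Φ₀ q.2 + q.1 * O q.2) (W ×ˢ Set.univ.pi fun j => ball (0 : ℂ) (R j)) :=
    (hΦ₀.comp analyticOnNhd_snd fun _ hq => hq.2).add (analyticOnNhd_fst.mul (hO.comp analyticOnNhd_snd fun _ hq => hq.2))
  refine norm_iteratedDeriv_tBoxMixedLetter_source_le hW hρ hρR hr hrR hκ hRκ S (E := fun μ' v => G v * cexp (Φ₀ v + μ' * O v))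
    (analyticOnNhd_mul_cexp (Φ := fun μ' v => Φ₀ v + μ' * O v) hG hΦ) k hμ fun t ht z hz => ?_
  rw [iteratedDeriv_mul_cexp_affine, norm_mul, norm_pow]
  exact mul_le_mul (pow_le_pow_left₀ (norm_nonneg _) (hR₁ t ht z hz) k) (hA t ht z hz) (norm_nonneg _) (pow_nonneg
    (le_trans (norm_nonneg _) (hR₁ t ht z hz)) k)

/-! ## §5 Decided checks: `E = exp(μ·t·z₀z₁)` — the letter is `μ`, its response the letter of the insertion `t·z₀z₁` -/

/-- [folklore] The coordinate functions are analytic on every polydisc; so are `1`, `0` and `t·z₀z₁` (W55 `analyticOnNhd_apply`). -/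
theorem analyticOnNhd_tzz (U : Set (Fin 3 → ℂ)) :
    AnalyticOnNhd ℂ (fun v : Fin 3 → ℂ => v 0 * (v (Fin.succ 0) * v (Fin.succ 1))) U :=
  ((analyticOnNhd_apply 0).mul ((analyticOnNhd_apply _).mul (analyticOnNhd_apply _))).mono (subset_univ _)

/-- DECIDED CHECK, first order: for `E(μ; t, z₀, z₁) = e^{μ·t·z₀z₁}` (`G = 1`, `Φ₀ = 0`, `O = t·z₀z₁`; `t_□`-radius `1 < 2`, cube radii `3∕2 < 2`)
at EVERY source `μ ∈ ℂ` the response of the letter is the letter of the insertion `O·E(μ)`, namely `Δ_{01}(∂_t|₀[t·z₀z₁·e^{μ t z₀z₁}]) =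
Δ_{01}(z₀z₁) = 1` — no window: the letter `(1.23)(E(μ)) = μ` is entire in the source. -/
example (μ : ℂ) : iteratedDeriv 1 (fun μ' : ℂ => ∫ θ₀ in Icc 0 (2 * Real.pi), w₁ 1 (0, θ₀) *
    ∫ p : Fin 2 → ℝ × ℝ, wS (fun _ => (3 / 2 : ℝ)) {0, 1} p *
      ((1 : ℂ) * cexp (0 + μ' * (circ 1 θ₀ * (σS (fun _ => (3 / 2 : ℝ)) {0, 1} p 0 * σS (fun _ => (3 / 2 : ℝ)) {0, 1} p 1))))
        ∂(Measure.pi (μS {0, 1}))) μ = 1 := by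
  have h := iteratedDeriv_tBoxMixedLetter_affine_source (n := 2) (W := univ) isOpen_univ (ρ := 1) one_pos (r := fun _ => 3 / 2)
    (R := fun _ => 2) (by norm_num) (fun _ => by norm_num) (fun _ => by norm_num) {0, 1} (G := fun _ => 1) (Φ₀ := fun _ => 0)
    (O := fun v => v 0 * (v (Fin.succ 0) * v (Fin.succ 1))) analyticOnNhd_const analyticOnNhd_const (analyticOnNhd_tzz _) 1 (mem_univ μ)
  simp only [Fin.cons_zero, Fin.cons_succ] at h
  rw [h]
  -- the letter of the inserted field `(t·z₀z₁)·e^{μ t z₀z₁}` (entire): `Δ_{01}` of its first `t_□`-variation `z₀z₁`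
  have h2 := tBoxMixedLetter_eq_mixedDiff_deriv_local (n := 2) (ρ := 1) one_pos (r := fun _ => 3 / 2) (R := fun _ => 2) (by norm_num)
    (fun _ => by norm_num) (fun _ => by norm_num) {0, 1}
    (E := fun v => (v 0 * (v (Fin.succ 0) * v (Fin.succ 1))) ^ 1 * ((1 : ℂ) * cexp (0 + μ * (v 0 * (v (Fin.succ 0) * v (Fin.succ 1))))))
    ((((analyticOnNhd_tzz _).pow 1).mul (analyticOnNhd_const.mul ((analyticOnNhd_const.add
      (analyticOnNhd_const.mul (analyticOnNhd_tzz _))).cexp))))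
  simp only [Fin.cons_zero, Fin.cons_succ] at h2
  rw [h2]
  have hd : ∀ c : ℂ, deriv (fun t : ℂ => (t * c) ^ 1 * ((1 : ℂ) * cexp (0 + μ * (t * c)))) 0 = c := fun c => by
    have ha : HasDerivAt (fun t : ℂ => (t * c) ^ 1) c 0 := by
      simpa using ((hasDerivAt_id (0 : ℂ)).mul_const c).fun_pow 1
    have hb : HasDerivAt (fun t : ℂ => (1 : ℂ) * cexp (0 + μ * (t * c))) (μ * (1 * c) * ((1 : ℂ) * cexp (0 + μ * (0 * c)))) 0 :=
      hasDerivAt_mul_cexp_source (G := 1) ((((hasDerivAt_id (0 : ℂ)).mul_const c).const_mul μ).const_add 0)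
    rw [(ha.fun_mul hb).deriv]
    simp
  simp_rw [hd, mixedDiff_pair]
  norm_num

/-- DECIDED CHECK, second order: on the same datum `∂²_μ (1.23)(μ) = (1.23)(O²·E(μ)) = Δ_{01}(∂_t|₀[(t·z₀z₁)²·e^{μ t z₀z₁}]) = 0` at every `μ` — the
letter `μ` is linear in the source. -/
example (μ : ℂ) : iteratedDeriv 2 (fun μ' : ℂ => ∫ θ₀ in Icc 0 (2 * Real.pi), w₁ 1 (0, θ₀) *
    ∫ p : Fin 2 → ℝ × ℝ, wS (fun _ => (3 / 2 : ℝ)) {0, 1} p *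
      ((1 : ℂ) * cexp (0 + μ' * (circ 1 θ₀ * (σS (fun _ => (3 / 2 : ℝ)) {0, 1} p 0 * σS (fun _ => (3 / 2 : ℝ)) {0, 1} p 1))))
        ∂(Measure.pi (μS {0, 1}))) μ = 0 := by
  have h := iteratedDeriv_tBoxMixedLetter_affine_source (n := 2) (W := univ) isOpen_univ (ρ := 1) one_pos (r := fun _ => 3 / 2)
    (R := fun _ => 2) (by norm_num) (fun _ => by norm_num) (fun _ => by norm_num) {0, 1} (G := fun _ => 1) (Φ₀ := fun _ => 0)
    (O := fun v => v 0 * (v (Fin.succ 0) * v (Fin.succ 1))) analyticOnNhd_const analyticOnNhd_const (analyticOnNhd_tzz _) 2 (mem_univ μ)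
  simp only [Fin.cons_zero, Fin.cons_succ] at h
  rw [h]
  have h2 := tBoxMixedLetter_eq_mixedDiff_deriv_local (n := 2) (ρ := 1) one_pos (r := fun _ => 3 / 2) (R := fun _ => 2) (by norm_num)
    (fun _ => by norm_num) (fun _ => by norm_num) {0, 1}
    (E := fun v => (v 0 * (v (Fin.succ 0) * v (Fin.succ 1))) ^ 2 * ((1 : ℂ) * cexp (0 + μ * (v 0 * (v (Fin.succ 0) * v (Fin.succ 1))))))
    ((((analyticOnNhd_tzz _).pow 2).mul (analyticOnNhd_const.mul ((analyticOnNhd_const.add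
      (analyticOnNhd_const.mul (analyticOnNhd_tzz _))).cexp))))
  simp only [Fin.cons_zero, Fin.cons_succ] at h2
  rw [h2]
  have hd : ∀ c : ℂ, deriv (fun t : ℂ => (t * c) ^ 2 * ((1 : ℂ) * cexp (0 + μ * (t * c)))) 0 = 0 := fun c => by
    have ha : HasDerivAt (fun t : ℂ => (t * c) ^ 2) 0 0 := by
      simpa using ((hasDerivAt_id (0 : ℂ)).mul_const c).fun_pow 2
    have hb : HasDerivAt (fun t : ℂ => (1 : ℂ) * cexp (0 + μ * (t * c))) (μ * (1 * c) * ((1 : ℂ) * cexp (0 + μ * (0 * c)))) 0 :=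
      hasDerivAt_mul_cexp_source (G := 1) ((((hasDerivAt_id (0 : ℂ)).mul_const c).const_mul μ).const_add 0)
    rw [(ha.fun_mul hb).deriv]
    simp
  simp_rw [hd, mixedDiff_pair]
  norm_num

end Summit.QuantumFields.BalabanUV.T4Continuum.NE1p.DressedSmallFieldTBoxMixedLetterSourceInsertion

end
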